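import Summits.QuantumFields.YangMills.Theses.BackwardLiouvilleRigidity
import Literature.MathematicalPhysics.QuantumFieldTheory.Balaban1983to89.BalabanAdmissibleClassParams

/-!
# Sketch for the repair card `organ-admissible-retype` (ym-r3-idea-1 g11) — NOT a route edit, nothing filed.

`OneStepBackwardContractionAdm` = the BLR organ 27939 with the two binders `0 < b₀ → 0 < p₀ → AdmissibleClassParams F γ b₀ p₀ prm →`
inserted (C′_R2, the minimal statement the twisted-fibre witness misses); `ClassLimitTrajectoriesAdm` = A♯ 22541 strengthened to deliver
`0 < pm` and admissible parameters (the coupling that keeps `closes` composable).  The two one-line theorems certify the directions: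
C → C′ (weakening of the organ) and A♯′ → A♯ (strengthening of the realisation crux).

v2 (18:4xZ): the CERTIFIED REV-5 PACKAGE — `BackwardChainLemmaAdm` (the support 27941 re-typed over the admissible organ; proof = the landed
`backwardChainLemma_proof` with the three binders threaded, verbatim otherwise) and `closesAdm : OneStepBackwardContractionAdm →
BackwardChainLemmaAdm → FlatRatioTermination → ClassLimitTrajectoriesAdm → YM3TorusSU2` (= the route's `closes` with `0 < pm` and the
admissibility certificate of A♯′ fed to the organ; verbatim otherwise).  So the re-type C′_R2 + A♯′ keeps the route deciding the R3 leaf, kernel-checked.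
Nothing here proves the organ, A♯, the rung or any summit statement; no route edit is made (not the pen).
-/

namespace Summit.QuantumFields.YangMills.Cruxes.OneStepBackwardContraction.AdmRetype

open Summit.QuantumFields.YangMills.Theses.BackwardLiouvilleRigidity

def OneStepBackwardContractionAdm : Prop :=
  open MeasureTheory Filter Topology Literature.MathematicalPhysics.QuantumFieldTheory.Balaban1983to89 T3ContinuumYM3Torus T3NestedUnitLaws T3UnitLawDensityEML T4Continuum BalabanUVClass T3UnitScaleTilt in ∃ γ₁ : ℝ, 0 < γ₁ ∧ ∀ (F : T3Family) (γ : ℝ), 0 < γ → γ ≤ γ₁ → ∀ (b₀ p₀ κ : ℝ) (j₀ : ℕ) (prm : ℕ → ClassParams) (η : ℕ → ℝ), 0 < b₀ → 0 < p₀ → AdmissibleClassParams F γ b₀ p₀ prm → 0 < κ → (∀ j, 0 ≤ η j) → Summable η → ∀ (μ μ' : ((j : ℕ) → MeasureTheory.Measure (GaugeField (F.P j) 0 ↥(Matrix.specialUnitaryGroup (Fin 2) ℂ)))) (ρ ρ' : ((j : ℕ) → GaugeField (F.P j) 0 ↥(Matrix.specialUnitaryGroup (Fin 2) ℂ) → ℝ)),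 (∀ j : ℕ, IsProbabilityMeasure (μ j) ∧ μ j = Measure.map (descend F ℰp j) (μ (j + 1))) → (∀ j : ℕ, IsProbabilityMeasure (μ' j) ∧ μ' j = Measure.map (descend F ℰp j) (μ' (j + 1))) → (∀ j : ℕ, j₀ ≤ j → ((∀ U, PlaqSmall (θBal F.L γ b₀ p₀ j) U → 0 < ρ j U ∧ 0 < ρ' j U) ∧ μ j = (fieldMeasure _ _ _).withDensity (fun U => ENNReal.ofReal (ρ j U)) ∧ μ' j = (fieldMeasure _ _ _).withDensity (fun U => ENNReal.ofReal (ρ' j U)) ∧ MemAtHeight F ℰp j (prm j) (ρ j) ∧ MemAtHeight F ℰp j (prm j) (ρ' j) ∧ μ j {U | ¬ PlaqSmall (θBal F.L γ b₀ p₀ j) U} ≤ ENNReal.ofReal (η j) ∧ μ' j {U | ¬ PlaqSmall (θBal F.L γ b₀ p₀ j) U} ≤ ENNReal.ofReal (η j) ∧ (ContinuousOn (ρ j) {U | PlaqSmall (θBal F.L γ b₀ p₀ j) U} ∧ ContinuousOn (ρ' j) {U | PlaqSmall (θBal F.L γ b₀ p₀ j) U}))) → ∃ (θ C w₀ : ℝ)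 (ε δ : ℕ → ℝ) (j₁ : ℕ), 0 < θ ∧ 0 ≤ C ∧ 0 < w₀ ∧ (∀ j, 0 ≤ ε j ∧ 0 ≤ δ j) ∧ Summable ε ∧ Summable δ ∧ Summable (fun i => ∑' k, δ (k + i)) ∧ Tendsto (fun j => (∑' k, δ (k + j)) * ((1 + 2 * ((F.L : ℝ) ^ j / γ) * (Fintype.card (Plaq (F.P j) 0) : ℝ)) * (Fintype.card (PBond (F.P j) 0) : ℝ) ^ 2)) atTop (𝓝 0) ∧ j₀ ≤ j₁ ∧ ∀ j : ℕ, j₁ ≤ j → ∀ (c : Plaq (F.P (j + 1)) 0 → ℝ) (a w : ℝ), 0 ≤ a → 0 ≤ w → a + θ * w ≤ w₀ → ((∀ p, |c p| ≤ a) ∧ (∀ (b b' : PBond (F.P (j + 1)) 0) U V W Z, PlaqSmall (θBal F.L γ b₀ p₀ (j + 1)) U → PlaqSmall (θBal F.L γ b₀ p₀ (j + 1)) V → PlaqSmall (θBal F.L γ b₀ p₀ (j + 1)) W → PlaqSmall (θBal F.L γ b₀ p₀ (j + 1)) Z → (∀ e, e ≠ b → U e = V e) → (∀ e, e ≠ b'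 → U e = W e) → (∀ e, e ≠ b' → V e = Z e) → (∀ e, e ≠ b → W e = Z e) → |(Real.log (ρ (j + 1) U) - Real.log (ρ' (j + 1) U) - ((F.L : ℝ) ^ (j + 1) / γ) * ∑ p, c p * (1 - reTr (GaugeField.plaqHol U p))) - (Real.log (ρ (j + 1) V) - Real.log (ρ' (j + 1) V) - ((F.L : ℝ) ^ (j + 1) / γ) * ∑ p, c p * (1 - reTr (GaugeField.plaqHol V p))) - ((Real.log (ρ (j + 1) W) - Real.log (ρ' (j + 1) W) - ((F.L : ℝ) ^ (j + 1) / γ) * ∑ p, c p * (1 - reTr (GaugeField.plaqHol W p))) - (Real.log (ρ (j + 1) Z) - Real.log (ρ' (j + 1) Z) - ((F.L : ℝ) ^ (j + 1) / γ) * ∑ p, c p * (1 - reTr (GaugeField.plaqHol Z p))))| ≤ w * Real.exp (-(κ * (b.src.tdist b'.src : ℝ))))) → ∃ (c' : Plaq (F.P j) 0 → ℝ) (a' w' : ℝ), 0 ≤ a' ∧ 0 ≤ w' ∧ a' + θ * w' ≤ (1 + ε j + C * (a + θ * w)) * (a + θ * w) + δ j ∧ ((∀ p, |c' p| ≤ a')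 ∧ (∀ (b b' : PBond (F.P j) 0) U V W Z, PlaqSmall (θBal F.L γ b₀ p₀ j) U → PlaqSmall (θBal F.L γ b₀ p₀ j) V → PlaqSmall (θBal F.L γ b₀ p₀ j) W → PlaqSmall (θBal F.L γ b₀ p₀ j) Z → (∀ e, e ≠ b → U e = V e) → (∀ e, e ≠ b' → U e = W e) → (∀ e, e ≠ b' → V e = Z e) → (∀ e, e ≠ b → W e = Z e) → |(Real.log (ρ j U) - Real.log (ρ' j U) - ((F.L : ℝ) ^ j / γ) * ∑ p, c' p * (1 - reTr (GaugeField.plaqHol U p))) - (Real.log (ρ j V) - Real.log (ρ' j V) - ((F.L : ℝ) ^ j / γ) * ∑ p, c' p * (1 - reTr (GaugeField.plaqHol V p))) - ((Real.log (ρ j W) - Real.log (ρ' j W) - ((F.L : ℝ) ^ j / γ) * ∑ p, c' p * (1 - reTr (GaugeField.plaqHol W p))) - (Real.log (ρ j Z) - Real.log (ρ' j Z) - ((F.L : ℝ) ^ j / γ) * ∑ p, c' p * (1 - reTr (GaugeField.plaqHol Z p))))| ≤ w' * Real.exp (-(κ * (b.src.tdist b'.src : ℝ)))))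

def ClassLimitTrajectoriesAdm : Prop :=
  open MeasureTheory Filter Topology Literature.MathematicalPhysics.QuantumFieldTheory.Balaban1983to89 T3ContinuumYM3Torus T3NestedUnitLaws T3UnitLawDensityEML T4Continuum BalabanUVClass T3UnitScaleTilt in ∃ pm : ℝ, 0 < pm ∧ ∀ (p₀ : ℝ), pm ≤ p₀ → ∃ γ₁ : ℝ, 0 < γ₁ ∧ ∀ (F : T3Family) (γ : ℝ), 0 < γ → γ ≤ γ₁ → ∃ (b₀ κ : ℝ) (j₀ : ℕ) (prm : ℕ → ClassParams) (ω η : ℕ → ℝ), 0 < b₀ ∧ AdmissibleClassParams F γ b₀ p₀ prm ∧ 0 < κ ∧ (∀ j, 0 ≤ ω j ∧ 0 ≤ η j) ∧ (∀ t : ℝ, 0 < t → ∀ N : ℕ, ∃ J : ℕ, N ≤ J ∧ (J : ℝ) * ω J < t) ∧ Summable η ∧ ∀ φ φ' : ℕ → ℕ, StrictMono φ → StrictMono φ' → ∃ ψ ψ' : ℕ → ℕ, StrictMono ψ ∧ StrictMono ψ' ∧ ∃ (μ μ' : ((j : ℕ) → MeasureTheory.Measure (GaugeField (F.P j) 0 ↥(Matrix.specialUnitaryGroup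 (Fin 2) ℂ)))) (ρ ρ' : ((j : ℕ) → GaugeField (F.P j) 0 ↥(Matrix.specialUnitaryGroup (Fin 2) ℂ) → ℝ)), (∀ j : ℕ, IsProbabilityMeasure (μ j) ∧ μ j = Measure.map (descend F ℰp j) (μ (j + 1))) ∧ (∀ j : ℕ, IsProbabilityMeasure (μ' j) ∧ μ' j = Measure.map (descend F ℰp j) (μ' (j + 1))) ∧ (StrictMono (φ ∘ ψ) ∧ ∀ os : List (ULoop3 F), Tendsto (fun i => (F.scheme ℰp γ).expectAt ((φ ∘ ψ) i) os) atTop (𝓝 (∫ u, (os.map fun C => loopAt u (C.1.atLevel 0)).prod ∂(μ 0)))) ∧ (StrictMono (φ' ∘ ψ') ∧ ∀ os : List (ULoop3 F), Tendsto (fun i => (F.scheme ℰp γ).expectAt ((φ' ∘ ψ') i) os) atTop (𝓝 (∫ u, (os.map fun C => loopAt u (C.1.atLevel 0)).prod ∂(μ' 0)))) ∧ (∀ j : ℕ, j₀ ≤ j → ((∀ U, PlaqSmall (θBal F.L γ b₀ p₀ j) U → 0 < ρ j U ∧ 0 < ρ' j U) ∧ μ j = (fieldMeasure _ _ _).withDensity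 (fun U => ENNReal.ofReal (ρ j U)) ∧ μ' j = (fieldMeasure _ _ _).withDensity (fun U => ENNReal.ofReal (ρ' j U)) ∧ MemAtHeight F ℰp j (prm j) (ρ j) ∧ MemAtHeight F ℰp j (prm j) (ρ' j) ∧ (∀ (b b' : PBond (F.P j) 0) U V W Z, PlaqSmall (θBal F.L γ b₀ p₀ j) U → PlaqSmall (θBal F.L γ b₀ p₀ j) V → PlaqSmall (θBal F.L γ b₀ p₀ j) W → PlaqSmall (θBal F.L γ b₀ p₀ j) Z → (∀ e, e ≠ b → U e = V e) → (∀ e, e ≠ b' → U e = W e) → (∀ e, e ≠ b' → V e = Z e) → (∀ e, e ≠ b → W e = Z e) → |(Real.log (ρ j U) - Real.log (ρ' j U)) - (Real.log (ρ j V) - Real.log (ρ' j V)) - ((Real.log (ρ j W) - Real.log (ρ' j W)) - (Real.log (ρ j Z) - Real.log (ρ' j Z)))| ≤ ω j * Real.exp (-(κ * (b.src.tdist b'.src : ℝ)))) ∧ μ j {U | ¬ PlaqSmall (θBal F.L γ b₀ p₀ j) U} ≤ ENNReal.ofReal (η j) ∧ μ' j {U | ¬ PlaqSmall (θBal F.L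 γ b₀ p₀ j) U} ≤ ENNReal.ofReal (η j) ∧ (ContinuousOn (ρ j) {U | PlaqSmall (θBal F.L γ b₀ p₀ j) U} ∧ ContinuousOn (ρ' j) {U | PlaqSmall (θBal F.L γ b₀ p₀ j) U}))) ∧ (∀ j : ℕ, j₀ ≤ j → μ j {U | ¬ PlaqSmall (θBal F.L γ (Real.sqrt b₀) (p₀ / 2) j) U} ≤ ENNReal.ofReal (η j) ∧ μ' j {U | ¬ PlaqSmall (θBal F.L γ (Real.sqrt b₀) (p₀ / 2) j) U} ≤ ENNReal.ofReal (η j))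

theorem adm_of_organ : OneStepBackwardContraction → OneStepBackwardContractionAdm := by
  rintro ⟨γ₁, hγ₁, H⟩
  exact ⟨γ₁, hγ₁, fun F γ hγ hle b₀ p₀ κ j₀ prm η _ _ _ => H F γ hγ hle b₀ p₀ κ j₀ prm η⟩

theorem classLimit_of_adm : ClassLimitTrajectoriesAdm → ClassLimitTrajectories := by
  rintro ⟨pm, _, H⟩
  refine ⟨pm, fun p₀ hp => ?_⟩
  obtain ⟨γ₁, hγ₁, H1⟩ := H p₀ hp
  refine ⟨γ₁, hγ₁, fun F γ hγ hle => ?_⟩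
  obtain ⟨b₀, κ, j₀, prm, ω, η, hb, _, rest⟩ := H1 F γ hγ hle
  exact ⟨b₀, κ, j₀, prm, ω, η, hb, rest⟩

def BackwardChainLemmaAdm : Prop :=
  open MeasureTheory Filter Topology Literature.MathematicalPhysics.QuantumFieldTheory.Balaban1983to89 T3ContinuumYM3Torus T3NestedUnitLaws T3UnitLawDensityEML T4Continuum BalabanUVClass T3UnitScaleTilt in OneStepBackwardContractionAdm → ∃ γ₁ : ℝ, 0 < γ₁ ∧ ∀ (F : T3Family) (γ : ℝ), 0 < γ → γ ≤ γ₁ → ∀ (b₀ p₀ κ : ℝ) (j₀ : ℕ) (prm : ℕ → ClassParams) (ω η : ℕ → ℝ), 0 < b₀ → 0 < p₀ → AdmissibleClassParams F γ b₀ p₀ prm → 0 < κ → (∀ j, 0 ≤ ω j ∧ 0 ≤ η j) → Summable η → ∀ (μ μ' : ((j : ℕ) → MeasureTheory.Measure (GaugeField (F.P j) 0 ↥(Matrix.specialUnitaryGroup (Fin 2) ℂ)))) (ρ ρ' : ((j : ℕ) → GaugeField (F.P j) 0 ↥(Matrix.specialUnitaryGroup (Fin 2) ℂ) → ℝ)),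 (∀ j : ℕ, IsProbabilityMeasure (μ j) ∧ μ j = Measure.map (descend F ℰp j) (μ (j + 1))) → (∀ j : ℕ, IsProbabilityMeasure (μ' j) ∧ μ' j = Measure.map (descend F ℰp j) (μ' (j + 1))) → (∀ j : ℕ, j₀ ≤ j → ((∀ U, PlaqSmall (θBal F.L γ b₀ p₀ j) U → 0 < ρ j U ∧ 0 < ρ' j U) ∧ μ j = (fieldMeasure _ _ _).withDensity (fun U => ENNReal.ofReal (ρ j U)) ∧ μ' j = (fieldMeasure _ _ _).withDensity (fun U => ENNReal.ofReal (ρ' j U)) ∧ MemAtHeight F ℰp j (prm j) (ρ j) ∧ MemAtHeight F ℰp j (prm j) (ρ' j) ∧ (∀ (b b' : PBond (F.P j) 0) U V W Z, PlaqSmall (θBal F.L γ b₀ p₀ j) U → PlaqSmall (θBal F.L γ b₀ p₀ j) V → PlaqSmall (θBal F.L γ b₀ p₀ j) W → PlaqSmall (θBal F.L γ b₀ p₀ j) Z → (∀ e, e ≠ b → U e = V e) → (∀ e, e ≠ b' → U e = W e) → (∀ e, e ≠ b' → V e = Z e) → (∀ e, e ≠ b → W e = Z e) → |(Real.log (ρ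 j U) - Real.log (ρ' j U)) - (Real.log (ρ j V) - Real.log (ρ' j V)) - ((Real.log (ρ j W) - Real.log (ρ' j W)) - (Real.log (ρ j Z) - Real.log (ρ' j Z)))| ≤ ω j * Real.exp (-(κ * (b.src.tdist b'.src : ℝ)))) ∧ μ j {U | ¬ PlaqSmall (θBal F.L γ b₀ p₀ j) U} ≤ ENNReal.ofReal (η j) ∧ μ' j {U | ¬ PlaqSmall (θBal F.L γ b₀ p₀ j) U} ≤ ENNReal.ofReal (η j) ∧ (ContinuousOn (ρ j) {U | PlaqSmall (θBal F.L γ b₀ p₀ j) U} ∧ ContinuousOn (ρ' j) {U | PlaqSmall (θBal F.L γ b₀ p₀ j) U}))) → ∃ (θ C w₀ : ℝ) (ε δ : ℕ → ℝ) (j₁ : ℕ), 0 < θ ∧ 0 ≤ C ∧ 0 < w₀ ∧ (∀ j, 0 ≤ ε j ∧ 0 ≤ δ j) ∧ Summable ε ∧ Summable δ ∧ Summable (fun i => ∑' k, δ (k + i)) ∧ Tendsto (fun j => (∑' k, δ (k + j)) * ((1 + 2 * ((F.L : ℝ) ^ j / γ) * (Fintype.card (Plaq (F.P j) 0) : ℝ))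 * (Fintype.card (PBond (F.P j) 0) : ℝ) ^ 2)) atTop (𝓝 0) ∧ j₀ ≤ j₁ ∧ ∀ (j J : ℕ), j₁ ≤ j → j ≤ J → Real.exp (∑' k, ε k + 1) * (θ * ω J + (∑' k, δ (k + j))) ≤ w₀ → C * (Real.exp (∑' k, ε k + 1) * ((J : ℝ) * (θ * ω J) + (∑' i, ∑' k, δ (k + (i + j))))) ≤ 1 → ∀ (b : PBond (F.P j) 0) U V, PlaqSmall (θBal F.L γ b₀ p₀ j) U → PlaqSmall (θBal F.L γ b₀ p₀ j) V → (∀ e, e ≠ b → U e = V e) → |(Real.log (ρ j U) - Real.log (ρ' j U)) - (Real.log (ρ j V) - Real.log (ρ' j V))| ≤ Real.exp (∑' k, ε k + 1) * (θ * ω J + (∑' k, δ (k + j))) * (1 / θ + 2 * ((F.L : ℝ) ^ j / γ) * (Fintype.card (Plaq (F.P j) 0) : ℝ))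

section ChainProof
open scoped BigOperators Topology Classical MeasureTheory Matrix
open Filter Set Function TopologicalSpace MeasureTheory

theorem backwardChainLemmaAdm_holds : BackwardChainLemmaAdm := by
  classical
  intro hC1
  obtain ⟨γ₁, hγ₁, h1⟩ := hC1
  refine ⟨γ₁, hγ₁, fun F γ hγ hle b₀ p₀ κ j₀ prm ω η hb₀ hp₀ hadm hκ hpos hη μ μ' ρ ρ' hc hc' hB => ?_⟩
  obtain ⟨θ, C, w₀, ε, δ, j₁, hθ, hC, hw₀, hεδ, hεs, hδs, hDs, hdec, hj₀₁, hstep⟩ :=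
    h1 F γ hγ hle b₀ p₀ κ j₀ prm η hb₀ hp₀ hadm hκ (fun j => (hpos j).2) hη μ μ' ρ ρ' hc hc'
      (fun j hj => by obtain ⟨a1, a2, a3, a4, a5, _, a7, a8, a9⟩ := hB j hj; exact ⟨a1, a2, a3, a4, a5, a7, a8, a9⟩)
  refine ⟨θ, C, w₀, ε, δ, j₁, hθ, hC, hw₀, hεδ, hεs, hδs, hDs, hdec, hj₀₁, fun j J hj hJj hsmall hquad b U V hU hV hUV => ?_⟩
  have hε0 : ∀ k, 0 ≤ ε k := fun k => (hεδ k).1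
  have hδ0 : ∀ k, 0 ≤ δ k := fun k => (hεδ k).2
  have hG : 0 < Real.exp (∑' k, ε k + 1) := Real.exp_pos _
  have hωJ : 0 ≤ ω J := (hpos J).1
  have hv0 : 0 ≤ (θ * ω J) := mul_nonneg hθ.le hωJ
  have hDnn : ∀ i : ℕ, 0 ≤ ∑' k, δ (k + i) := fun i => tsum_nonneg fun k => hδ0 _
  have hDsucc : ∀ i : ℕ, ∑' k, δ (k + i) = δ i + ∑' k, δ (k + (i + 1)) := by
    intro i
    have hs : Summable (fun k => δ (k + i)) := (summable_nat_add_iff (f := δ) i).mpr hδs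
    rw [hs.tsum_eq_zero_add]
    simp only [zero_add]
    congr 1
    exact tsum_congr fun k => by rw [show k + 1 + i = k + (i + 1) by omega]
  have hDanti : ∀ i : ℕ, ∑' k, δ (k + (i + 1)) ≤ ∑' k, δ (k + i) := fun i => by
    rw [hDsucc i]; linarith [hδ0 i]
  have hDmono : Antitone (fun i : ℕ => ∑' k, δ (k + i)) := antitone_nat_of_succ_le hDanti
  have hsumD : ∀ i : ℕ, j ≤ i → ∑ n ∈ Finset.Ico i J, (∑' k, δ (k + (n + 1))) ≤ (∑' i, ∑' k, δ (k + (i + j))) := by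
    intro i hji
    have hDs' : Summable (fun n => ∑' k, δ (k + (n + j))) := (summable_nat_add_iff (f := fun i => ∑' k, δ (k + i)) j).mpr hDs
    calc ∑ n ∈ Finset.Ico i J, (∑' k, δ (k + (n + 1)))
        ≤ ∑ k ∈ Finset.Ico i J, ∑' m, δ (m + k) := Finset.sum_le_sum fun k _ => hDanti k
      _ ≤ ∑ k ∈ Finset.Ico j J, ∑' m, δ (m + k) :=
          Finset.sum_le_sum_of_subset_of_nonneg (Finset.Ico_subset_Ico hji le_rfl) fun k _ _ => hDnn k
      _ = ∑ n ∈ Finset.range (J - j), ∑' m, δ (m + (j + n)) := Finset.sum_Ico_eq_sum_range _ _ _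
      _ = ∑ n ∈ Finset.range (J - j), ∑' m, δ (m + (n + j)) := by
          refine Finset.sum_congr rfl fun n _ => ?_
          rw [Nat.add_comm j n]
      _ ≤ (∑' i, ∑' k, δ (k + (i + j))) := hDs'.sum_le_tsum _ fun n _ => hDnn _
  have hsumε : ∀ i : ℕ, ∑ k ∈ Finset.Ico i J, ε k ≤ ∑' k, ε k := fun i => hεs.sum_le_tsum _ fun k _ => hε0 k
  have hEXPO : ∀ i : ℕ, j ≤ i → (∑ k ∈ Finset.Ico i J, ε k + C * (Real.exp (∑' k, ε k + 1) * (((J - i : ℕ) : ℝ) * (θ * ω J) + ∑ n ∈ Finset.Ico i J, (∑' k, δ (k + (n + 1)))))) ≤ ∑' k, ε k + 1 := by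
    intro i hji
    have h1 := hsumε i
    have hJi : ((J - i : ℕ) : ℝ) ≤ (J : ℝ) := by exact_mod_cast Nat.sub_le J i
    have h3 : ((J - i : ℕ) : ℝ) * (θ * ω J) + ∑ n ∈ Finset.Ico i J, (∑' k, δ (k + (n + 1))) ≤ (J : ℝ) * (θ * ω J) + (∑' i, ∑' k, δ (k + (i + j))) :=
      add_le_add (mul_le_mul_of_nonneg_right hJi hv0) (hsumD i hji)
    have h2 : C * (Real.exp (∑' k, ε k + 1) * (((J - i : ℕ) : ℝ) * (θ * ω J) + ∑ n ∈ Finset.Ico i J, (∑' k, δ (k + (n + 1))))) ≤ 1 :=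
      le_trans (mul_le_mul_of_nonneg_left (mul_le_mul_of_nonneg_left h3 hG.le) hC) hquad
    linarith
  have hEXPOnn : ∀ i : ℕ, 0 ≤ (∑ k ∈ Finset.Ico i J, ε k + C * (Real.exp (∑' k, ε k + 1) * (((J - i : ℕ) : ℝ) * (θ * ω J) + ∑ n ∈ Finset.Ico i J, (∑' k, δ (k + (n + 1)))))) := fun i =>
    add_nonneg (Finset.sum_nonneg fun k _ => hε0 k)
      (mul_nonneg hC (mul_nonneg hG.le (add_nonneg (mul_nonneg (Nat.cast_nonneg _) hv0)
        (Finset.sum_nonneg fun n _ => hDnn (n + 1)))))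
  have claim : ∀ n : ℕ, ∀ i : ℕ, i + n = J → j ≤ i → ∃ (c : Literature.MathematicalPhysics.QuantumFieldTheory.Balaban1983to89.Plaq (F.P i) 0 → ℝ) (a w : ℝ), 0 ≤ a ∧ 0 ≤ w ∧ a + θ * w ≤ Real.exp (∑ k ∈ Finset.Ico i J, ε k + C * (Real.exp (∑' k, ε k + 1) * (((J - i : ℕ) : ℝ) * (θ * ω J) + ∑ n ∈ Finset.Ico i J, (∑' k, δ (k + (n + 1)))))) * ((θ * ω J) + (∑' k, δ (k + i))) ∧ ((∀ p, |c p| ≤ a) ∧ (∀ (b b' : Literature.MathematicalPhysics.QuantumFieldTheory.Balaban1983to89.PBond (F.P i) 0) U V W Z, Literature.MathematicalPhysics.QuantumFieldTheory.Balaban1983to89.PlaqSmall (Literature.MathematicalPhysics.QuantumFieldTheory.Balaban1983to89.T3UnitScaleTilt.θBal F.L γ b₀ p₀ i) U → Literature.MathematicalPhysics.QuantumFieldTheory.Balaban1983to89.PlaqSmall (Literature.MathematicalPhysics.QuantumFieldTheory.Balaban1983to89.T3UnitScaleTilt.θBal F.L γ b₀ p₀ i) V → Literature.MathematicalPhysics.QuantumFieldTheory.Balaban1983to89.PlaqSmall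 (Literature.MathematicalPhysics.QuantumFieldTheory.Balaban1983to89.T3UnitScaleTilt.θBal F.L γ b₀ p₀ i) W → Literature.MathematicalPhysics.QuantumFieldTheory.Balaban1983to89.PlaqSmall (Literature.MathematicalPhysics.QuantumFieldTheory.Balaban1983to89.T3UnitScaleTilt.θBal F.L γ b₀ p₀ i) Z → (∀ e, e ≠ b → U e = V e) → (∀ e, e ≠ b' → U e = W e) → (∀ e, e ≠ b' → V e = Z e) → (∀ e, e ≠ b → W e = Z e) → |(Real.log (ρ i U) - Real.log (ρ' i U) - ((F.L : ℝ) ^ i / γ) * ∑ p, c p * (1 - Literature.MathematicalPhysics.QuantumFieldTheory.Balaban1983to89.reTr (Literature.MathematicalPhysics.QuantumFieldTheory.Balaban1983to89.GaugeField.plaqHol U p))) - (Real.log (ρ i V) - Real.log (ρ' i V) - ((F.L : ℝ) ^ i / γ) * ∑ p, c p * (1 - Literature.MathematicalPhysics.QuantumFieldTheory.Balaban1983to89.reTr (Literature.MathematicalPhysics.QuantumFieldTheory.Balaban1983to89.GaugeField.plaqHol V p))) - ((Real.log (ρ i W) - Real.log (ρ' i W) - ((F.L : ℝ) ^ i / γ)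 * ∑ p, c p * (1 - Literature.MathematicalPhysics.QuantumFieldTheory.Balaban1983to89.reTr (Literature.MathematicalPhysics.QuantumFieldTheory.Balaban1983to89.GaugeField.plaqHol W p))) - (Real.log (ρ i Z) - Real.log (ρ' i Z) - ((F.L : ℝ) ^ i / γ) * ∑ p, c p * (1 - Literature.MathematicalPhysics.QuantumFieldTheory.Balaban1983to89.reTr (Literature.MathematicalPhysics.QuantumFieldTheory.Balaban1983to89.GaugeField.plaqHol Z p))))| ≤ w * Real.exp (-(κ * (b.src.tdist b'.src : ℝ))))) := by
    intro n
    induction n with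
    | zero =>
      intro i hi hji
      obtain ⟨gposS, gμ, gμ', gmem, gmem', gosc2, gtl, gtl', gcont⟩ := hB i (by omega)
      have hiJ : J = i := by omega
      refine ⟨fun _ => 0, 0, ω i, le_rfl, (hpos i).1, ?_, ?_, ?_⟩
      · rw [zero_add]
        calc θ * ω i = 1 * (θ * ω i) := (one_mul _).symm
          _ ≤ Real.exp (∑ k ∈ Finset.Ico i J, ε k + C * (Real.exp (∑' k, ε k + 1) * (((J - i : ℕ) : ℝ) * (θ * ω J) + ∑ n ∈ Finset.Ico i J, (∑' k, δ (k + (n + 1)))))) * ((θ * ω J) + (∑' k, δ (k + i))) :=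
            mul_le_mul (Real.one_le_exp (hEXPOnn i)) (by rw [hiJ]; linarith [hDnn i])
              (mul_nonneg hθ.le (hpos i).1) (Real.exp_pos _).le
      · intro p; simp
      · intro b b' U V W Z hU hV hW hZ h1 h2 h3 h4
        simp only [zero_mul, Finset.sum_const_zero, mul_zero, sub_zero]
        exact gosc2 b b' U V W Z hU hV hW hZ h1 h2 h3 h4
    | succ n ih =>
      intro i hi hji
      have hiJ : i < J := by omega
      have hj1i : j₁ ≤ i := le_trans hj hji
      obtain ⟨c, a, w, ha, hw, hVb, hadm⟩ := ih (i + 1) (by omega) (by omega)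
      have hVnn : 0 ≤ a + θ * w := add_nonneg ha (mul_nonneg hθ.le hw)
      have hx1 : 0 ≤ (θ * ω J) + (∑' k, δ (k + (i + 1))) := add_nonneg hv0 (hDnn _)
      have hB1 : a + θ * w ≤ Real.exp (∑' k, ε k + 1) * ((θ * ω J) + (∑' k, δ (k + (i + 1)))) :=
        hVb.trans (mul_le_mul_of_nonneg_right (Real.exp_le_exp.mpr (hEXPO (i + 1) (by omega))) hx1)
      have hside : a + θ * w ≤ w₀ := by
        have hD' : (∑' k, δ (k + (i + 1))) ≤ (∑' k, δ (k + j)) := hDmono (show j ≤ i + 1 by omega)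
        have : Real.exp (∑' k, ε k + 1) * ((θ * ω J) + (∑' k, δ (k + (i + 1)))) ≤ Real.exp (∑' k, ε k + 1) * (θ * ω J + (∑' k, δ (k + j))) := mul_le_mul_of_nonneg_left (by linarith) hG.le
        exact hB1.trans (this.trans hsmall)
      obtain ⟨c', a', w', ha', hw', hV', hadm'⟩ := hstep i hj1i c a w ha hw hside hadm
      refine ⟨c', a', w', ha', hw', ?_, hadm'⟩
      have hfac : 1 + ε i + C * (a + θ * w) ≤ Real.exp (ε i + C * (Real.exp (∑' k, ε k + 1) * ((θ * ω J) + (∑' k, δ (k + (i + 1)))))) := by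
        have h1 : C * (a + θ * w) ≤ C * (Real.exp (∑' k, ε k + 1) * ((θ * ω J) + (∑' k, δ (k + (i + 1))))) := mul_le_mul_of_nonneg_left hB1 hC
        have h2 := Real.add_one_le_exp (ε i + C * (Real.exp (∑' k, ε k + 1) * ((θ * ω J) + (∑' k, δ (k + (i + 1))))))
        linarith
      have hprod : 1 ≤ Real.exp (ε i + C * (Real.exp (∑' k, ε k + 1) * ((θ * ω J) + (∑' k, δ (k + (i + 1)))))) * Real.exp (∑ k ∈ Finset.Ico (i + 1) J, ε k + C * (Real.exp (∑' k, ε k + 1) * (((J - (i + 1) : ℕ) : ℝ) * (θ * ω J) + ∑ n ∈ Finset.Ico (i + 1) J, (∑' k, δ (k + (n + 1)))))) := by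
        rw [← Real.exp_add]
        exact Real.one_le_exp (add_nonneg (add_nonneg (hε0 i) (mul_nonneg hC (mul_nonneg hG.le hx1))) (hEXPOnn (i + 1)))
      have hIcoε : ∑ k ∈ Finset.Ico i J, ε k = ε i + ∑ k ∈ Finset.Ico (i + 1) J, ε k :=
        Finset.sum_eq_sum_Ico_succ_bot hiJ _
      have hIcoD : ∑ n ∈ Finset.Ico i J, (∑' k, δ (k + (n + 1))) = (∑' k, δ (k + (i + 1))) + ∑ n ∈ Finset.Ico (i + 1) J, (∑' k, δ (k + (n + 1))) :=
        Finset.sum_eq_sum_Ico_succ_bot hiJ (fun n => (∑' k, δ (k + (n + 1))))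
      have hsub : ((J - i : ℕ) : ℝ) = ((J - (i + 1) : ℕ) : ℝ) + 1 := by
        have : (J - i : ℕ) = (J - (i + 1)) + 1 := by omega
        rw [this]; push_cast; ring
      have hE : (ε i + C * (Real.exp (∑' k, ε k + 1) * ((θ * ω J) + (∑' k, δ (k + (i + 1)))))) + (∑ k ∈ Finset.Ico (i + 1) J, ε k + C * (Real.exp (∑' k, ε k + 1) * (((J - (i + 1) : ℕ) : ℝ) * (θ * ω J) + ∑ n ∈ Finset.Ico (i + 1) J, (∑' k, δ (k + (n + 1)))))) = (∑ k ∈ Finset.Ico i J, ε k + C * (Real.exp (∑' k, ε k + 1) * (((J - i : ℕ) : ℝ) * (θ * ω J) + ∑ n ∈ Finset.Ico i J, (∑' k, δ (k + (n + 1)))))) := by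
        rw [hIcoε, hIcoD, hsub]; ring
      calc a' + θ * w' ≤ (1 + ε i + C * (a + θ * w)) * (a + θ * w) + δ i := hV'
        _ ≤ Real.exp (ε i + C * (Real.exp (∑' k, ε k + 1) * ((θ * ω J) + (∑' k, δ (k + (i + 1)))))) * (Real.exp (∑ k ∈ Finset.Ico (i + 1) J, ε k + C * (Real.exp (∑' k, ε k + 1) * (((J - (i + 1) : ℕ) : ℝ) * (θ * ω J) + ∑ n ∈ Finset.Ico (i + 1) J, (∑' k, δ (k + (n + 1)))))) * ((θ * ω J) + (∑' k, δ (k + (i + 1))))) + δ i := by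
            have := mul_le_mul hfac hVb hVnn (Real.exp_pos _).le
            linarith
        _ ≤ Real.exp (ε i + C * (Real.exp (∑' k, ε k + 1) * ((θ * ω J) + (∑' k, δ (k + (i + 1)))))) * Real.exp (∑ k ∈ Finset.Ico (i + 1) J, ε k + C * (Real.exp (∑' k, ε k + 1) * (((J - (i + 1) : ℕ) : ℝ) * (θ * ω J) + ∑ n ∈ Finset.Ico (i + 1) J, (∑' k, δ (k + (n + 1)))))) * ((θ * ω J) + (∑' k, δ (k + (i + 1))) + δ i) := by
            have hδ' : δ i ≤ Real.exp (ε i + C * (Real.exp (∑' k, ε k + 1) * ((θ * ω J) + (∑' k, δ (k + (i + 1)))))) * Real.exp (∑ k ∈ Finset.Ico (i + 1) J, ε k + C * (Real.exp (∑' k, ε k + 1) * (((J - (i + 1) : ℕ) : ℝ) * (θ * ω J) + ∑ n ∈ Finset.Ico (i + 1) J, (∑' k, δ (k + (n + 1)))))) * δ i := le_mul_of_one_le_left (hδ0 i) hprod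
            have hring : Real.exp (ε i + C * (Real.exp (∑' k, ε k + 1) * ((θ * ω J) + (∑' k, δ (k + (i + 1)))))) * (Real.exp (∑ k ∈ Finset.Ico (i + 1) J, ε k + C * (Real.exp (∑' k, ε k + 1) * (((J - (i + 1) : ℕ) : ℝ) * (θ * ω J) + ∑ n ∈ Finset.Ico (i + 1) J, (∑' k, δ (k + (n + 1)))))) * ((θ * ω J) + (∑' k, δ (k + (i + 1))))) + δ i
                = Real.exp (ε i + C * (Real.exp (∑' k, ε k + 1) * ((θ * ω J) + (∑' k, δ (k + (i + 1)))))) * Real.exp (∑ k ∈ Finset.Ico (i + 1) J, ε k + C * (Real.exp (∑' k, ε k + 1) * (((J - (i + 1) : ℕ) : ℝ) * (θ * ω J) + ∑ n ∈ Finset.Ico (i + 1) J, (∑' k, δ (k + (n + 1)))))) * ((θ * ω J) + (∑' k, δ (k + (i + 1))) + δ i)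
                  - (Real.exp (ε i + C * (Real.exp (∑' k, ε k + 1) * ((θ * ω J) + (∑' k, δ (k + (i + 1)))))) * Real.exp (∑ k ∈ Finset.Ico (i + 1) J, ε k + C * (Real.exp (∑' k, ε k + 1) * (((J - (i + 1) : ℕ) : ℝ) * (θ * ω J) + ∑ n ∈ Finset.Ico (i + 1) J, (∑' k, δ (k + (n + 1)))))) * δ i - δ i) := by ring
            rw [hring]; linarith [hδ']
        _ = Real.exp (∑ k ∈ Finset.Ico i J, ε k + C * (Real.exp (∑' k, ε k + 1) * (((J - i : ℕ) : ℝ) * (θ * ω J) + ∑ n ∈ Finset.Ico i J, (∑' k, δ (k + (n + 1)))))) * ((θ * ω J) + (∑' k, δ (k + i))) := by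
            rw [← Real.exp_add, hE, hDsucc i]; ring
  obtain ⟨c, a, w, ha, hw, hVb, hcB, hadm2⟩ := claim (J - j) j (by omega) le_rfl
  have hXnn : 0 ≤ Real.exp (∑' k, ε k + 1) * (θ * ω J + (∑' k, δ (k + j))) := mul_nonneg hG.le (add_nonneg hv0 (hDnn j))
  have hBf : a + θ * w ≤ Real.exp (∑' k, ε k + 1) * (θ * ω J + (∑' k, δ (k + j))) :=
    hVb.trans (mul_le_mul_of_nonneg_right (Real.exp_le_exp.mpr (hEXPO j le_rfl)) (add_nonneg hv0 (hDnn j)))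
  have hwB : w ≤ Real.exp (∑' k, ε k + 1) * (θ * ω J + (∑' k, δ (k + j))) / θ := by
    rw [le_div_iff₀ hθ]
    calc w * θ = θ * w := mul_comm _ _
      _ ≤ a + θ * w := le_add_of_nonneg_left ha
      _ ≤ Real.exp (∑' k, ε k + 1) * (θ * ω J + (∑' k, δ (k + j))) := hBf
  have haB : a ≤ Real.exp (∑' k, ε k + 1) * (θ * ω J + (∑' k, δ (k + j))) := le_trans (le_add_of_nonneg_right (mul_nonneg hθ.le hw)) hBf
  have htr : ∀ g : ↥(Matrix.specialUnitaryGroup (Fin 2) ℂ), |Literature.MathematicalPhysics.QuantumFieldTheory.Balaban1983to89.reTr g| ≤ 1 := fun g =>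
    Literature.MathematicalPhysics.QuantumFieldTheory.Balaban1983to89.RegularGaugeGroup.abs_reTr_le_one g
  have hmarg : ∀ (ι : Type) [Fintype ι] (c f g : ι → ℝ) (a : ℝ), 0 ≤ a → (∀ p, |c p| ≤ a) → (∀ p, |f p| ≤ 1) →
      (∀ p, |g p| ≤ 1) → |(∑ p, c p * (1 - f p)) - (∑ p, c p * (1 - g p))| ≤ (Fintype.card ι : ℝ) * (a * 2) := by
    intro ι _ c f g a ha hcB hf hg
    rw [← Finset.sum_sub_distrib]
    refine (Finset.abs_sum_le_sum_abs _ _).trans ?_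
    have hterm : ∀ p ∈ (Finset.univ : Finset ι), |c p * (1 - f p) - c p * (1 - g p)| ≤ a * 2 := by
      intro p _
      rw [← mul_sub, abs_mul]
      have h1 := hf p
      have h2 := hg p
      have hdiff : |(1 - f p) - (1 - g p)| ≤ 2 := by
        rw [abs_le] at h1 h2 ⊢; constructor <;> linarith [h1.1, h1.2, h2.1, h2.2]
      exact mul_le_mul (hcB p) hdiff (abs_nonneg _) ha
    refine (Finset.sum_le_sum hterm).trans ?_
    rw [Finset.sum_const, Finset.card_univ, nsmul_eq_mul]
  have hβ : 0 ≤ ((F.L : ℝ) ^ j / γ) := by positivity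
  have hNp : 0 ≤ (Fintype.card (Literature.MathematicalPhysics.QuantumFieldTheory.Balaban1983to89.Plaq (F.P j) 0) : ℝ) := by positivity
  have hq : Real.exp (-(κ * (b.src.tdist b.src : ℝ))) ≤ 1 :=
    Real.exp_le_one_iff.mpr (neg_nonpos.mpr (mul_nonneg hκ.le (Nat.cast_nonneg _)))
  have fin : ∀ (x y su sv q : ℝ), q ≤ 1 → |x - ((F.L : ℝ) ^ j / γ) * su - (y - ((F.L : ℝ) ^ j / γ) * sv) - ((x - ((F.L : ℝ) ^ j / γ) * su) - (x - ((F.L : ℝ) ^ j / γ) * su))| ≤ w * q →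
      |su - sv| ≤ (Fintype.card (Literature.MathematicalPhysics.QuantumFieldTheory.Balaban1983to89.Plaq (F.P j) 0) : ℝ) * (a * 2) → |x - y| ≤ Real.exp (∑' k, ε k + 1) * (θ * ω J + (∑' k, δ (k + j))) * (1 / θ + 2 * ((F.L : ℝ) ^ j / γ) * (Fintype.card (Literature.MathematicalPhysics.QuantumFieldTheory.Balaban1983to89.Plaq (F.P j) 0) : ℝ)) := by
    intro x y su sv q hq1 hxy0 hs
    have hxy : |x - ((F.L : ℝ) ^ j / γ) * su - (y - ((F.L : ℝ) ^ j / γ) * sv)| ≤ w := by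
      rw [sub_self, sub_zero] at hxy0
      exact hxy0.trans (mul_le_of_le_one_right hw hq1)
    have e : x - y = (x - ((F.L : ℝ) ^ j / γ) * su - (y - ((F.L : ℝ) ^ j / γ) * sv)) + ((F.L : ℝ) ^ j / γ) * (su - sv) := by ring
    rw [e]
    refine (abs_add_le _ _).trans ?_
    rw [abs_mul, abs_of_nonneg hβ]
    have ha2 : a * 2 ≤ Real.exp (∑' k, ε k + 1) * (θ * ω J + (∑' k, δ (k + j))) * 2 := by linarith
    calc |x - ((F.L : ℝ) ^ j / γ) * su - (y - ((F.L : ℝ) ^ j / γ) * sv)| + ((F.L : ℝ) ^ j / γ) * |su - sv|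
        ≤ w + ((F.L : ℝ) ^ j / γ) * ((Fintype.card (Literature.MathematicalPhysics.QuantumFieldTheory.Balaban1983to89.Plaq (F.P j) 0) : ℝ) * (a * 2)) := add_le_add hxy (mul_le_mul_of_nonneg_left hs hβ)
      _ ≤ Real.exp (∑' k, ε k + 1) * (θ * ω J + (∑' k, δ (k + j))) / θ + ((F.L : ℝ) ^ j / γ) * ((Fintype.card (Literature.MathematicalPhysics.QuantumFieldTheory.Balaban1983to89.Plaq (F.P j) 0) : ℝ) * (Real.exp (∑' k, ε k + 1) * (θ * ω J + (∑' k, δ (k + j))) * 2)) :=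
          add_le_add hwB (mul_le_mul_of_nonneg_left (mul_le_mul_of_nonneg_left ha2 hNp) hβ)
      _ = Real.exp (∑' k, ε k + 1) * (θ * ω J + (∑' k, δ (k + j))) * (1 / θ + 2 * ((F.L : ℝ) ^ j / γ) * (Fintype.card (Literature.MathematicalPhysics.QuantumFieldTheory.Balaban1983to89.Plaq (F.P j) 0) : ℝ)) := by ring
  exact fin _ _ _ _ _ hq
    (hadm2 b b U V U U hU hV hU hU hUV (fun e _ => rfl) (fun e he => (hUV e he).symm) (fun e _ => rfl))
    (hmarg _ c (fun p => Literature.MathematicalPhysics.QuantumFieldTheory.Balaban1983to89.reTr (Literature.MathematicalPhysics.QuantumFieldTheory.Balaban1983to89.GaugeField.plaqHol U p)) (fun p => Literature.MathematicalPhysics.QuantumFieldTheory.Balaban1983to89.reTr (Literature.MathematicalPhysics.QuantumFieldTheory.Balaban1983to89.GaugeField.plaqHol V p)) a ha hcB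
      (fun p => htr _) (fun p => htr _))

theorem closesAdm (hC1 : OneStepBackwardContractionAdm) (hL : BackwardChainLemmaAdm) (hC2 : FlatRatioTermination)
    (hA : ClassLimitTrajectoriesAdm) :
    Literature.MathematicalPhysics.QuantumFieldTheory.Balaban1983to89.T3YM3TorusStatement.YM3TorusSU2 := by
  classical
  obtain ⟨pT, γ₂, hγ₂, h2⟩ := hC2
  obtain ⟨pm, hpm, hA⟩ := hA
  obtain ⟨γA, hγA, hA⟩ := hA (max pm pT) (le_max_left _ _)
  obtain ⟨γ₁, hγ₁, h1⟩ := hL hC1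
  refine ⟨min γA (min γ₁ γ₂), lt_min hγA (lt_min hγ₁ hγ₂), fun F γ hγ hle => ?_⟩
  rw [Literature.MathematicalPhysics.QuantumFieldTheory.Balaban1983to89.T3ContinuumYM3Torus.continuumYM3Torus_iff_hasUniqueLimitPoints_SU
    F Literature.MathematicalPhysics.QuantumFieldTheory.Balaban1983to89.T3UnitLawDensityEML.ℰp
    Literature.MathematicalPhysics.QuantumFieldTheory.Balaban1983to89.T3UnitLawDensityEML.measurableE_ℰp hγ.le]
  intro os φ ψ hφ hψ l l' hl hl'
  have hγA' : γ ≤ γA := hle.trans (min_le_left _ _)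
  have hγ1 : γ ≤ γ₁ := hle.trans ((min_le_right _ _).trans (min_le_left _ _))
  have hγ2 : γ ≤ γ₂ := hle.trans ((min_le_right _ _).trans (min_le_right _ _))
  obtain ⟨b₀, κ, j₀, prm, ω, η, hb₀, hadm, hκ, hpos, hlim, hη, hpair⟩ := hA F γ hγ hγA'
  obtain ⟨ψ₁, ψ₁', hψ₁, hψ₁', μ, μ', ρ, ρ', hc, hc', hr, hr', hB, hIn⟩ := hpair φ ψ hφ hψ
  obtain ⟨θ, C, w₀, ε, δ, j₁, hθ, hC, hw₀, hεδ, hεs, hδs, hDs, hdec, hj₀₁, hchain⟩ :=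
    h1 F γ hγ hγ1 b₀ (max pm pT) κ j₀ prm ω η hb₀ (lt_max_of_lt_left hpm) hadm hκ hpos hη μ μ' ρ ρ' hc hc' hB
  have h2' := h2 F γ hγ hγ2 b₀ (max pm pT) κ j₀ prm ω η (le_max_right _ _) hb₀ hκ hpos hη μ μ' ρ ρ' hc hc' hB hIn
  have hG : 0 < Real.exp (∑' k, ε k + 1) := Real.exp_pos _
  have hδ0 : ∀ k, 0 ≤ δ k := fun k => (hεδ k).2
  have hDnn : ∀ i : ℕ, 0 ≤ ∑' k, δ (k + i) := fun i => tsum_nonneg fun k => hδ0 _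
  have hEnn : ∀ i : ℕ, 0 ≤ ∑' n, ∑' k, δ (k + (n + i)) := fun i => tsum_nonneg fun n => hDnn _
  have hD0 : Tendsto (fun i => ∑' k, δ (k + i)) atTop (𝓝 0) := tendsto_sum_nat_add δ
  have hE0 : Tendsto (fun i => ∑' n, ∑' k, δ (k + (n + i))) atTop (𝓝 0) :=
    tendsto_sum_nat_add fun n => ∑' k, δ (k + n)
  obtain ⟨N₁, hN₁⟩ := Metric.tendsto_atTop.mp hD0 (w₀ / 2 / Real.exp (∑' k, ε k + 1)) (by positivity)
  obtain ⟨N₂, hN₂⟩ := Metric.tendsto_atTop.mp hE0 (1 / (2 * (C + 1) * Real.exp (∑' k, ε k + 1))) (by positivity)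
  have e := h2' ⟨max j₁ (max N₁ N₂), hj₀₁.trans (le_max_left _ _), fun j => Real.exp (∑' k, ε k + 1) * (1 / θ + 1) * ((∑' k, δ (k + j)) * (1 + 2 * ((F.L : ℝ) ^ j / γ) * (Fintype.card (Literature.MathematicalPhysics.QuantumFieldTheory.Balaban1983to89.Plaq (F.P j) 0) : ℝ))), fun j hj b U V hU hV hUV => by
    have hj₁ : j₁ ≤ j := (le_max_left _ _).trans hj
    have hN₁j : N₁ ≤ j := ((le_max_left _ _).trans (le_max_right _ _)).trans hj
    have hN₂j : N₂ ≤ j := ((le_max_right _ _).trans (le_max_right _ _)).trans hj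
    have hDj : ∑' k, δ (k + j) < w₀ / 2 / Real.exp (∑' k, ε k + 1) := by
      have := hN₁ j hN₁j
      rwa [Real.dist_eq, sub_zero, abs_of_nonneg (hDnn j)] at this
    have hEj : (∑' i, ∑' k, δ (k + (i + j))) < 1 / (2 * (C + 1) * Real.exp (∑' k, ε k + 1)) := by
      have := hN₂ j hN₂j
      rwa [Real.dist_eq, sub_zero, abs_of_nonneg (hEnn j)] at this
    have hβ : 0 ≤ ((F.L : ℝ) ^ j / γ) := by positivity
    have hNp : 0 ≤ (Fintype.card (Literature.MathematicalPhysics.QuantumFieldTheory.Balaban1983to89.Plaq (F.P j) 0) : ℝ) := by positivity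
    have hQ : 0 < (1 / θ + 2 * ((F.L : ℝ) ^ j / γ) * (Fintype.card (Literature.MathematicalPhysics.QuantumFieldTheory.Balaban1983to89.Plaq (F.P j) 0) : ℝ)) := by positivity
    have key : ∀ t : ℝ, 0 < t → |(Real.log (ρ j U) - Real.log (ρ' j U)) - (Real.log (ρ j V) - Real.log (ρ' j V))| ≤ Real.exp (∑' k, ε k + 1) * (1 / θ + 1) * ((∑' k, δ (k + j)) * (1 + 2 * ((F.L : ℝ) ^ j / γ) * (Fintype.card (Literature.MathematicalPhysics.QuantumFieldTheory.Balaban1983to89.Plaq (F.P j) 0) : ℝ))) + t := by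
      intro t ht
      obtain ⟨J, hJN, hJ⟩ := hlim (min (t / (Real.exp (∑' k, ε k + 1) * θ * (1 / θ + 2 * ((F.L : ℝ) ^ j / γ) * (Fintype.card (Literature.MathematicalPhysics.QuantumFieldTheory.Balaban1983to89.Plaq (F.P j) 0) : ℝ)) + 1)) (min (w₀ / (2 * Real.exp (∑' k, ε k + 1) * θ)) (1 / (2 * (C + 1) * Real.exp (∑' k, ε k + 1) * θ))))
        (by positivity) (max j 1)
      have hJj : j ≤ J := (le_max_left _ _).trans hJN
      have hJ1 : (1 : ℝ) ≤ (J : ℝ) := by exact_mod_cast (le_max_right j 1).trans hJN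
      have hωJ : 0 ≤ ω J := (hpos J).1
      have hωJ' : ω J ≤ (J : ℝ) * ω J := le_mul_of_one_le_left hωJ hJ1
      have hx : 0 ≤ (J : ℝ) * ω J := mul_nonneg (Nat.cast_nonneg _) hωJ
      have hlt1 : (J : ℝ) * ω J < t / (Real.exp (∑' k, ε k + 1) * θ * (1 / θ + 2 * ((F.L : ℝ) ^ j / γ) * (Fintype.card (Literature.MathematicalPhysics.QuantumFieldTheory.Balaban1983to89.Plaq (F.P j) 0) : ℝ)) + 1) := lt_of_lt_of_le hJ (min_le_left _ _)
      have hlt2 : (J : ℝ) * ω J < w₀ / (2 * Real.exp (∑' k, ε k + 1) * θ) := lt_of_lt_of_le hJ ((min_le_right _ _).trans (min_le_left _ _))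
      have hlt3 : (J : ℝ) * ω J < 1 / (2 * (C + 1) * Real.exp (∑' k, ε k + 1) * θ) :=
        lt_of_lt_of_le hJ ((min_le_right _ _).trans (min_le_right _ _))
      have hsmall : Real.exp (∑' k, ε k + 1) * (θ * ω J + (∑' k, δ (k + j))) ≤ w₀ := by
        have h' : ω J < w₀ / (2 * Real.exp (∑' k, ε k + 1) * θ) := lt_of_le_of_lt hωJ' hlt2
        have h1 := (lt_div_iff₀ (by positivity)).mp h'
        have h2 := (lt_div_iff₀ hG).mp hDj
        have e' : Real.exp (∑' k, ε k + 1) * (θ * ω J + (∑' k, δ (k + j))) = Real.exp (∑' k, ε k + 1) * θ * ω J + (∑' k, δ (k + j)) * Real.exp (∑' k, ε k + 1) := by ring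
        rw [e']; linarith
      have hquad : C * (Real.exp (∑' k, ε k + 1) * ((J : ℝ) * (θ * ω J) + (∑' i, ∑' k, δ (k + (i + j))))) ≤ 1 := by
        have h3 := (lt_div_iff₀ (by positivity)).mp hlt3
        have h4 := (lt_div_iff₀ (by positivity)).mp hEj
        have hy : 0 ≤ Real.exp (∑' k, ε k + 1) * ((J : ℝ) * (θ * ω J)) := mul_nonneg hG.le (mul_nonneg (Nat.cast_nonneg _) (mul_nonneg hθ.le hωJ))
        have h5 : C * (Real.exp (∑' k, ε k + 1) * ((J : ℝ) * (θ * ω J))) ≤ (C + 1) * (Real.exp (∑' k, ε k + 1) * ((J : ℝ) * (θ * ω J))) :=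
          mul_le_mul_of_nonneg_right (by linarith) hy
        have h6 : C * (Real.exp (∑' k, ε k + 1) * (∑' i, ∑' k, δ (k + (i + j)))) ≤ (C + 1) * (Real.exp (∑' k, ε k + 1) * (∑' i, ∑' k, δ (k + (i + j)))) := mul_le_mul_of_nonneg_right (by linarith) (mul_nonneg hG.le (hEnn j))
        have e' : C * (Real.exp (∑' k, ε k + 1) * ((J : ℝ) * (θ * ω J) + (∑' i, ∑' k, δ (k + (i + j))))) = C * (Real.exp (∑' k, ε k + 1) * ((J : ℝ) * (θ * ω J))) + C * (Real.exp (∑' k, ε k + 1) * (∑' i, ∑' k, δ (k + (i + j)))) := by ring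
        have e5 : (C + 1) * (Real.exp (∑' k, ε k + 1) * ((J : ℝ) * (θ * ω J))) = ((J : ℝ) * ω J * (2 * (C + 1) * Real.exp (∑' k, ε k + 1) * θ)) / 2 := by ring
        have e6 : (C + 1) * (Real.exp (∑' k, ε k + 1) * (∑' i, ∑' k, δ (k + (i + j)))) = ((∑' i, ∑' k, δ (k + (i + j))) * (2 * (C + 1) * Real.exp (∑' k, ε k + 1))) / 2 := by ring
        rw [e']; linarith
      have hb := hchain j J hj₁ hJj hsmall hquad b U V hU hV hUV
      have hω' : Real.exp (∑' k, ε k + 1) * θ * (1 / θ + 2 * ((F.L : ℝ) ^ j / γ) * (Fintype.card (Literature.MathematicalPhysics.QuantumFieldTheory.Balaban1983to89.Plaq (F.P j) 0) : ℝ)) * ω J ≤ t := by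
        have h' : ω J < t / (Real.exp (∑' k, ε k + 1) * θ * (1 / θ + 2 * ((F.L : ℝ) ^ j / γ) * (Fintype.card (Literature.MathematicalPhysics.QuantumFieldTheory.Balaban1983to89.Plaq (F.P j) 0) : ℝ)) + 1) := lt_of_le_of_lt hωJ' hlt1
        have h1 := (lt_div_iff₀ (by positivity)).mp h'
        have e' : ω J * (Real.exp (∑' k, ε k + 1) * θ * (1 / θ + 2 * ((F.L : ℝ) ^ j / γ) * (Fintype.card (Literature.MathematicalPhysics.QuantumFieldTheory.Balaban1983to89.Plaq (F.P j) 0) : ℝ)) + 1) = Real.exp (∑' k, ε k + 1) * θ * (1 / θ + 2 * ((F.L : ℝ) ^ j / γ) * (Fintype.card (Literature.MathematicalPhysics.QuantumFieldTheory.Balaban1983to89.Plaq (F.P j) 0) : ℝ)) * ω J + ω J := by ring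
        linarith
      have hD' : Real.exp (∑' k, ε k + 1) * (∑' k, δ (k + j)) * (1 / θ + 2 * ((F.L : ℝ) ^ j / γ) * (Fintype.card (Literature.MathematicalPhysics.QuantumFieldTheory.Balaban1983to89.Plaq (F.P j) 0) : ℝ)) ≤ Real.exp (∑' k, ε k + 1) * (1 / θ + 1) * ((∑' k, δ (k + j)) * (1 + 2 * ((F.L : ℝ) ^ j / γ) * (Fintype.card (Literature.MathematicalPhysics.QuantumFieldTheory.Balaban1983to89.Plaq (F.P j) 0) : ℝ))) := by
        have hθi : 0 ≤ 1 / θ := by positivity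
        have hQ' : (1 / θ + 2 * ((F.L : ℝ) ^ j / γ) * (Fintype.card (Literature.MathematicalPhysics.QuantumFieldTheory.Balaban1983to89.Plaq (F.P j) 0) : ℝ)) ≤ (1 / θ + 1) * (1 + 2 * ((F.L : ℝ) ^ j / γ) * (Fintype.card (Literature.MathematicalPhysics.QuantumFieldTheory.Balaban1983to89.Plaq (F.P j) 0) : ℝ)) := by
          nlinarith [mul_nonneg hθi (mul_nonneg (mul_nonneg zero_le_two hβ) hNp)]
        calc Real.exp (∑' k, ε k + 1) * (∑' k, δ (k + j)) * (1 / θ + 2 * ((F.L : ℝ) ^ j / γ) * (Fintype.card (Literature.MathematicalPhysics.QuantumFieldTheory.Balaban1983to89.Plaq (F.P j) 0) : ℝ)) = (Real.exp (∑' k, ε k + 1) * (∑' k, δ (k + j))) * (1 / θ + 2 * ((F.L : ℝ) ^ j / γ) * (Fintype.card (Literature.MathematicalPhysics.QuantumFieldTheory.Balaban1983to89.Plaq (F.P j) 0) : ℝ)) := by ring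
          _ ≤ (Real.exp (∑' k, ε k + 1) * (∑' k, δ (k + j))) * ((1 / θ + 1) * (1 + 2 * ((F.L : ℝ) ^ j / γ) * (Fintype.card (Literature.MathematicalPhysics.QuantumFieldTheory.Balaban1983to89.Plaq (F.P j) 0) : ℝ))) :=
              mul_le_mul_of_nonneg_left hQ' (mul_nonneg hG.le (hDnn j))
          _ = Real.exp (∑' k, ε k + 1) * (1 / θ + 1) * ((∑' k, δ (k + j)) * (1 + 2 * ((F.L : ℝ) ^ j / γ) * (Fintype.card (Literature.MathematicalPhysics.QuantumFieldTheory.Balaban1983to89.Plaq (F.P j) 0) : ℝ))) := by ring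
      calc |(Real.log (ρ j U) - Real.log (ρ' j U)) - (Real.log (ρ j V) - Real.log (ρ' j V))| ≤ Real.exp (∑' k, ε k + 1) * (θ * ω J + (∑' k, δ (k + j))) * (1 / θ + 2 * ((F.L : ℝ) ^ j / γ) * (Fintype.card (Literature.MathematicalPhysics.QuantumFieldTheory.Balaban1983to89.Plaq (F.P j) 0) : ℝ)) := hb
        _ = Real.exp (∑' k, ε k + 1) * θ * (1 / θ + 2 * ((F.L : ℝ) ^ j / γ) * (Fintype.card (Literature.MathematicalPhysics.QuantumFieldTheory.Balaban1983to89.Plaq (F.P j) 0) : ℝ)) * ω J + Real.exp (∑' k, ε k + 1) * (∑' k, δ (k + j)) * (1 / θ + 2 * ((F.L : ℝ) ^ j / γ) * (Fintype.card (Literature.MathematicalPhysics.QuantumFieldTheory.Balaban1983to89.Plaq (F.P j) 0) : ℝ)) := by ring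
        _ ≤ t + Real.exp (∑' k, ε k + 1) * (1 / θ + 1) * ((∑' k, δ (k + j)) * (1 + 2 * ((F.L : ℝ) ^ j / γ) * (Fintype.card (Literature.MathematicalPhysics.QuantumFieldTheory.Balaban1983to89.Plaq (F.P j) 0) : ℝ))) := add_le_add hω' hD'
        _ = Real.exp (∑' k, ε k + 1) * (1 / θ + 1) * ((∑' k, δ (k + j)) * (1 + 2 * ((F.L : ℝ) ^ j / γ) * (Fintype.card (Literature.MathematicalPhysics.QuantumFieldTheory.Balaban1983to89.Plaq (F.P j) 0) : ℝ))) + t := by ring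
    exact le_of_forall_pos_le_add key, by
    have h := hdec.const_mul (Real.exp (∑' k, ε k + 1) * (1 / θ + 1))
    rw [mul_zero] at h
    exact Filter.Tendsto.congr (fun j => by ring) h⟩ os
  have e1 := tendsto_nhds_unique (hl.comp hψ₁.tendsto_atTop) (hr.2 os)
  have e2 := tendsto_nhds_unique (hl'.comp hψ₁'.tendsto_atTop) (hr'.2 os)
  rw [e1, e2, e]

/-- The rev-5 deciding theorem with the (proved) admissible chain lemma discharged: three load-bearing binders —
the admissible organ (crux), `FlatRatioTermination` (support 22542, unchanged) and the admissible A♯ (crux). -/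
theorem closesAdm' (hC1 : OneStepBackwardContractionAdm) (hC2 : FlatRatioTermination) (hA : ClassLimitTrajectoriesAdm) :
    Literature.MathematicalPhysics.QuantumFieldTheory.Balaban1983to89.T3YM3TorusStatement.YM3TorusSU2 :=
  closesAdm hC1 backwardChainLemmaAdm_holds hC2 hA

end ChainProof

end Summit.QuantumFields.YangMills.Cruxes.OneStepBackwardContraction.AdmRetype
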